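import Literature.Analysis.OperatorTheory.DeflatedFormBound
import Mathlib.Algebra.QuadraticDiscriminant
import HarnessLib

/-!
# Crux `DressedRitz` (stmt-QuantumFields-20205), line «polyakovlift», stub S-LEAK `stub_liftLeakage` — support I:
# operator-free forms layer (variance = least squared residual; Pythagorean split against exact eigenvectors; `K² ≤ ΛK`)

Support module (fleet seat ym-20205-polyakovlift-s1; `--supports stmt-QuantumFields-20205`, helper, no closure claim).  The registered stub
`Summit.QuantumFields.YangMills.Cruxes.DressedRitz.PolyakovLift.stub_liftLeakage` is clause (o4) of `OpPlat.PlateauClauses`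
(`‖K_βu‖²‖u‖² − ⟨u,K_βu⟩² ≤ C(λ³/L²)λ₀²‖u‖⁴` for the lifted channel vectors).  This file is the ABSTRACT layer, in the operator-free language
of the tree's Kato–Temple engine (`Literature/Analysis/OperatorTheory/ClusterKatoTempleBound.lean`: a real vector space `D`, a symmetric
positive semidefinite bilinear form `ip`, an `ip`-symmetric linear `K`); the companion `…LiftLeakageResidual.lean` instantiates it on
`physSubmodule L`, `l2Form L`, `transferOp β` and spells the stub's clause texts.

* `variance_eq_residual_sub_sq`: for EVERY `a`, `ip(Kx,Kx)ip(x,x) − ip(x,Kx)² = ip(x,x)·ip((K−a)x,(K−a)x) − (a·ip(x,x) − ip(x,Kx))²` — the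
  variance is `ip(x,x)` times the LEAST squared residual over approximate eigenvalues `a`, attained at the Rayleigh quotient
  (`variance_le_residual`, `residual_rayleigh_eq_variance`) [Kato 1949 §1: `ε² = (Kw,Kw) − η²`];
* `residual_split`: against `ip`-orthonormal exact eigenvectors `e_j` (`K e_j = λ_j e_j`, `j < N`) the squared residual splits EXACTLY
  (Pythagoras, no cross term) into the slow part `Σ_j (λ_j − a)² ip(x,e_j)²` and the squared residual of the remainder `r = x − Σ_j ip(x,e_j)e_j`;
* `form_sq_le_dom` ∕ `form_sq_le_dom_sq` ∕ `residual_remainder_le`: on a `K`-stable class of vectors on which `0 ≤ ip(y,Ky) ≤ Λ ip(y,y)`: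
  `ip(Kr,Kr) ≤ Λ ip(r,Kr) ≤ Λ² ip(r,r)` (Cauchy–Schwarz for the `K`-form + domination of `Kr`) and `ip((K−a)r,(K−a)r) ≤ max(a²,(Λ−a)²) ip(r,r)`;
* `variance_le_form_mul_spread`: globally dominated `K` (`Λ` = top of the spectrum): variance `≤ ip(x,Kx)·(Λ ip(x,x) − ip(x,Kx))`.

HONEST FRAMING: elementary linear algebra serving bookkeeping on the conditional femto rung R2b1; the stub stays OPEN; nothing here bears on
infinite volume, the continuum limit or the Clay gap.
References: T. Kato, J. Phys. Soc. Japan 4 (1949) 334 [cite: Kato1949, §1]; M. Reed, B. Simon IV (1978) Thm XIII.1 [cite: ReedSimonIV1978].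
-/

set_option autoImplicit false

noncomputable section

open Finset
open Literature.Analysis.OperatorTheory
open scoped BigOperators

namespace Summit.QuantumFields.YangMills.Theorems.FemtoTransferGap.LiftLeak

section Abstract

variable {D : Type*} [AddCommGroup D] [Module ℝ D]

/-- Cauchy–Schwarz for a positive semidefinite symmetric bilinear form (discriminant of `t ↦ B(x+ty, x+ty) ≥ 0`). [folklore] -/
theorem bilin_sq_le (B : D →ₗ[ℝ] D →ₗ[ℝ] ℝ) (hsymm : ∀ x y, B x y = B y x) (hpos : ∀ x, 0 ≤ B x x) (x y : D) :
    (B x y) ^ 2 ≤ B x x * B y y := by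
  have hquad : ∀ t : ℝ, 0 ≤ B y y * (t * t) + 2 * B x y * t + B x x := by
    intro t
    have h := hpos (x + t • y)
    have e : B (x + t • y) (x + t • y) = B y y * (t * t) + 2 * B x y * t + B x x := by
      simp only [map_add, map_smul, LinearMap.add_apply, LinearMap.smul_apply, smul_eq_mul, hsymm y x]
      ring
    rwa [e] at h
  have hd := discrim_le_zero hquad
  rw [discrim] at hd
  nlinarith [hd]

/-- **Variance = ‖x‖² × squared residual − mismatch², for EVERY approximate eigenvalue `a`:**
`ip(Kx,Kx)·ip(x,x) − ip(x,Kx)² = ip(x,x)·ip(Kx − a x, Kx − a x) − (a·ip(x,x) − ip(x,Kx))²` (a polynomial identity; `ip` symmetric).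
So the variance is `ip(x,x)` times the least squared residual over `a`, attained at the Rayleigh quotient. [cite: Kato1949, §1] -/
theorem variance_eq_residual_sub_sq (ip : D →ₗ[ℝ] D →ₗ[ℝ] ℝ) (hip : ∀ x y, ip x y = ip y x) (K : D →ₗ[ℝ] D)
    (x : D) (a : ℝ) :
    ip (K x) (K x) * ip x x - ip x (K x) ^ 2 =
      ip x x * ip (K x - a • x) (K x - a • x) - (a * ip x x - ip x (K x)) ^ 2 := by
  have h1 : ip (K x) x = ip x (K x) := hip _ _
  simp only [map_sub, map_smul, LinearMap.sub_apply, LinearMap.smul_apply, smul_eq_mul, h1]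
  ring

/-- **Variance ≤ ‖x‖² × squared residual** for every approximate eigenvalue `a`. [cite: Kato1949, §1] -/
theorem variance_le_residual (ip : D →ₗ[ℝ] D →ₗ[ℝ] ℝ) (hip : ∀ x y, ip x y = ip y x) (K : D →ₗ[ℝ] D)
    (x : D) (a : ℝ) :
    ip (K x) (K x) * ip x x - ip x (K x) ^ 2 ≤ ip x x * ip (K x - a • x) (K x - a • x) := by
  rw [variance_eq_residual_sub_sq ip hip K x a]
  nlinarith [sq_nonneg (a * ip x x - ip x (K x))]

/-- **The Rayleigh quotient realises the variance**: for `ip(x,x) ≠ 0` and `a = ip(x,Kx)/ip(x,x)` the mismatch vanishes and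
`ip(x,x)·ip(Kx − a x, Kx − a x)` IS the variance. [cite: Kato1949, §1] -/
theorem residual_rayleigh_eq_variance (ip : D →ₗ[ℝ] D →ₗ[ℝ] ℝ) (hip : ∀ x y, ip x y = ip y x) (K : D →ₗ[ℝ] D)
    (x : D) (hx : ip x x ≠ 0) :
    ip x x * ip (K x - (ip x (K x) / ip x x) • x) (K x - (ip x (K x) / ip x x) • x) =
      ip (K x) (K x) * ip x x - ip x (K x) ^ 2 := by
  rw [variance_eq_residual_sub_sq ip hip K x (ip x (K x) / ip x x), div_mul_cancel₀ _ hx, sub_self,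
    zero_pow two_ne_zero, sub_zero]

/-- The remainder `r = x − Σ_{j<N} ip(x,e_j) e_j` of `x` after removing its components along `ip`-orthonormal vectors `e_j` is
`ip`-orthogonal to every `e_l`. [folklore] -/
theorem ip_remainder_eq_zero (ip : D →ₗ[ℝ] D →ₗ[ℝ] ℝ) {N : ℕ} (e : Fin N → D)
    (hon : ∀ i l, ip (e i) (e l) = if i = l then 1 else 0) (x : D) (l : Fin N) :
    ip (x - ∑ j, ip x (e j) • e j) (e l) = 0 := by
  rw [map_sub, LinearMap.sub_apply, bilin_sum_smul_left]
  simp only [hon, mul_ite, mul_one, mul_zero, Finset.sum_ite_eq', Finset.mem_univ, if_true, sub_self]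

/-- For an `ip`-symmetric `K` and exact eigenvectors `K e_l = λ_l e_l`: a vector `ip`-orthogonal to every `e_l` stays orthogonal after
applying `K` (`ip(K r, e_l) = ip(r, K e_l) = λ_l ip(r, e_l) = 0`). [folklore] -/
theorem ip_apply_eigen_eq_zero (ip : D →ₗ[ℝ] D →ₗ[ℝ] ℝ) (K : D →ₗ[ℝ] D) (hK : ∀ x y, ip (K x) y = ip x (K y))
    {N : ℕ} (e : Fin N → D) (ev : Fin N → ℝ) (heig : ∀ j, K (e j) = ev j • e j)
    {r : D} (hr : ∀ l, ip r (e l) = 0) (l : Fin N) : ip (K r) (e l) = 0 := by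
  rw [hK, heig, map_smul, smul_eq_mul, hr, mul_zero]

/-- **Pythagorean split of the squared residual against exact eigenvectors.**  `ip` symmetric, `K` `ip`-symmetric, `e_0 … e_{N−1}`
`ip`-orthonormal with `K e_j = λ_j e_j`.  For every `x` and every `a`, with `r = x − Σ_j ip(x,e_j) e_j`:
`ip((K−a)x, (K−a)x) = Σ_j (λ_j − a)² ip(x,e_j)² + ip((K−a)r, (K−a)r)` — slow part (explicit levels × weights) plus the squared residual
of the remainder, with NO cross term (`K − a` preserves the span and its `ip`-orthocomplement). [cite: ReedSimonIV1978, Thm XIII.1] -/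
theorem residual_split (ip : D →ₗ[ℝ] D →ₗ[ℝ] ℝ) (hip : ∀ x y, ip x y = ip y x) (K : D →ₗ[ℝ] D)
    (hK : ∀ x y, ip (K x) y = ip x (K y)) {N : ℕ} (e : Fin N → D) (ev : Fin N → ℝ)
    (hon : ∀ i l, ip (e i) (e l) = if i = l then 1 else 0) (heig : ∀ j, K (e j) = ev j • e j) (x : D) (a : ℝ) :
    ip (K x - a • x) (K x - a • x) =
      ∑ j, (ev j - a) ^ 2 * ip x (e j) ^ 2 +
        ip (K (x - ∑ j, ip x (e j) • e j) - a • (x - ∑ j, ip x (e j) • e j))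
          (K (x - ∑ j, ip x (e j) • e j) - a • (x - ∑ j, ip x (e j) • e j)) := by
  classical
  set r : D := x - ∑ j, ip x (e j) • e j with hr_def
  have hr : ∀ l, ip r (e l) = 0 := ip_remainder_eq_zero ip e hon x
  have hKr : ∀ l, ip (K r) (e l) = 0 := ip_apply_eigen_eq_zero ip K hK e ev heig hr
  -- `(K − a) x = A + B`, `A = Σ (ip(x,e_j)(λ_j − a)) • e_j`, `B = (K − a) r`
  set A : D := ∑ j, (ip x (e j) * (ev j - a)) • e j with hA_def
  set B : D := K r - a • r with hB_def
  have hx : x = (∑ j, ip x (e j) • e j) + r := by rw [hr_def]; abel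
  have hdecomp : K x - a • x = A + B := by
    have hKp : K (∑ j, ip x (e j) • e j) = ∑ j, (ip x (e j) * ev j) • e j := by
      rw [map_sum]
      refine sum_congr rfl fun j _ => ?_
      rw [map_smul, heig, smul_smul]
    have hAeq : A = (∑ j, (ip x (e j) * ev j) • e j) - a • ∑ j, ip x (e j) • e j := by
      rw [hA_def, smul_sum, ← Finset.sum_sub_distrib]
      refine sum_congr rfl fun j _ => ?_
      rw [smul_smul, ← sub_smul]
      congr 1
      ring
    conv_lhs => rw [hx]
    rw [map_add, hKp, smul_add, hAeq, hB_def]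
    abel
  -- the three Gram entries
  have hAB : ip A B = 0 := by
    rw [hA_def, bilin_sum_smul_left]
    refine sum_eq_zero fun j _ => ?_
    rw [hB_def, map_sub, map_smul, smul_eq_mul, hip (e j) (K r), hKr j, hip (e j) r, hr j]
    ring
  have hBA : ip B A = 0 := by rw [hip]; exact hAB
  have hAA : ip A A = ∑ j, (ev j - a) ^ 2 * ip x (e j) ^ 2 := by
    rw [hA_def, bilin_sum_smul_sum_smul]
    refine sum_congr rfl fun j _ => ?_
    simp only [hon, mul_ite, mul_one, mul_zero, Finset.sum_ite_eq, Finset.mem_univ, if_true]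
    ring
  rw [hdecomp]
  simp only [map_add, LinearMap.add_apply, hAB, hBA, hAA, add_zero, zero_add]

/-- **`K² ≤ ΛK` on a `K`-stable dominated class.**  `ip` symmetric positive semidefinite, `K` `ip`-symmetric with non-negative form
`ip(y,Ky) ≥ 0`; on a class `P` of vectors stable under `K` on which `ip(y,Ky) ≤ Λ ip(y,y)` (`Λ ≥ 0`): `ip(Kr,Kr) ≤ Λ·ip(r,Kr)` for `r ∈ P`
(Cauchy–Schwarz for the `K`-form: `ip(Kr,Kr)² = ip(r,K(Kr))² ≤ ip(r,Kr)·ip(Kr,K(Kr)) ≤ ip(r,Kr)·Λ·ip(Kr,Kr)`). [cite: ReedSimonIV1978, Thm XIII.1] -/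
theorem form_sq_le_dom (ip : D →ₗ[ℝ] D →ₗ[ℝ] ℝ) (hip : ∀ x y, ip x y = ip y x) (hip0 : ∀ y, 0 ≤ ip y y) (K : D →ₗ[ℝ] D)
    (hK : ∀ x y, ip (K x) y = ip x (K y)) (hpos : ∀ y, 0 ≤ ip y (K y))
    (P : D → Prop) (hPK : ∀ y, P y → P (K y)) {Λ : ℝ} (hΛ : 0 ≤ Λ) (hdom : ∀ y, P y → ip y (K y) ≤ Λ * ip y y)
    {r : D} (hr : P r) : ip (K r) (K r) ≤ Λ * ip r (K r) := by
  -- Cauchy–Schwarz for the positive semidefinite symmetric form `(y,z) ↦ ip y (K z)`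
  have hcs : (ip r (K (K r))) ^ 2 ≤ ip r (K r) * ip (K r) (K (K r)) := by
    have h := bilin_sq_le (ip.compl₂ K) (fun y z => by
      simp only [LinearMap.compl₂_apply]; rw [← hK y z]; exact hip (K y) z) (fun y => by
      simp only [LinearMap.compl₂_apply]; exact hpos y) r (K r)
    simpa only [LinearMap.compl₂_apply] using h
  have hX : ip (K r) (K r) = ip r (K (K r)) := hK r (K r)
  have hdomKr : ip (K r) (K (K r)) ≤ Λ * ip (K r) (K r) := hdom _ (hPK _ hr)
  have hX0 : 0 ≤ ip (K r) (K r) := hip0 _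
  have hrKr : 0 ≤ ip r (K r) := hpos r
  -- `X² ≤ ip(r,Kr) · (Λ · X)`
  have hsq : ip (K r) (K r) ^ 2 ≤ ip r (K r) * (Λ * ip (K r) (K r)) :=
    calc ip (K r) (K r) ^ 2 = ip r (K (K r)) ^ 2 := by rw [hX]
      _ ≤ ip r (K r) * ip (K r) (K (K r)) := hcs
      _ ≤ ip r (K r) * (Λ * ip (K r) (K r)) := mul_le_mul_of_nonneg_left hdomKr hrKr
  rcases hX0.eq_or_lt with h0 | hXpos
  · rw [← h0]; exact mul_nonneg hΛ hrKr
  · have : ip (K r) (K r) * ip (K r) (K r) ≤ (Λ * ip r (K r)) * ip (K r) (K r) := by nlinarith [hsq]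
    exact le_of_mul_le_mul_right this hXpos

/-- On the same class: `ip(Kr,Kr) ≤ Λ² ip(r,r)`. [cite: ReedSimonIV1978, Thm XIII.1] -/
theorem form_sq_le_dom_sq (ip : D →ₗ[ℝ] D →ₗ[ℝ] ℝ) (hip : ∀ x y, ip x y = ip y x) (hip0 : ∀ y, 0 ≤ ip y y) (K : D →ₗ[ℝ] D)
    (hK : ∀ x y, ip (K x) y = ip x (K y)) (hpos : ∀ y, 0 ≤ ip y (K y))
    (P : D → Prop) (hPK : ∀ y, P y → P (K y)) {Λ : ℝ} (hΛ : 0 ≤ Λ) (hdom : ∀ y, P y → ip y (K y) ≤ Λ * ip y y)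
    {r : D} (hr : P r) : ip (K r) (K r) ≤ Λ ^ 2 * ip r r := by
  have h1 := form_sq_le_dom ip hip hip0 K hK hpos P hPK hΛ hdom hr
  have h2 := hdom r hr
  nlinarith [h1, h2]

/-- **Squared residual of a dominated remainder.**  On the same class, for every `a`:
`ip((K−a)r, (K−a)r) ≤ max(a², (Λ−a)²)·ip(r,r)` (the spectrum of `K` on the class lies in `[0, Λ]`; form version via `K² ≤ ΛK`,
`0 ≤ K ≤ Λ`). [cite: ReedSimonIV1978, Thm XIII.1] -/
theorem residual_remainder_le (ip : D →ₗ[ℝ] D →ₗ[ℝ] ℝ) (hip : ∀ x y, ip x y = ip y x) (hip0 : ∀ y, 0 ≤ ip y y)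
    (K : D →ₗ[ℝ] D) (hK : ∀ x y, ip (K x) y = ip x (K y)) (hpos : ∀ y, 0 ≤ ip y (K y))
    (P : D → Prop) (hPK : ∀ y, P y → P (K y)) {Λ : ℝ} (hΛ : 0 ≤ Λ) (hdom : ∀ y, P y → ip y (K y) ≤ Λ * ip y y)
    {r : D} (hr : P r) (a : ℝ) :
    ip (K r - a • r) (K r - a • r) ≤ max (a ^ 2) ((Λ - a) ^ 2) * ip r r := by
  have h1 := form_sq_le_dom ip hip hip0 K hK hpos P hPK hΛ hdom hr
  have h2 := hdom r hr
  have h3 := hpos r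
  have h4 := hip0 r
  have hKrr : ip (K r) r = ip r (K r) := hip _ _
  have hexp : ip (K r - a • r) (K r - a • r) = ip (K r) (K r) - 2 * a * ip r (K r) + a ^ 2 * ip r r := by
    simp only [map_sub, map_smul, LinearMap.sub_apply, LinearMap.smul_apply, smul_eq_mul, hKrr]
    ring
  rw [hexp]
  rcases le_or_gt (Λ - 2 * a) 0 with hle | hlt
  · calc ip (K r) (K r) - 2 * a * ip r (K r) + a ^ 2 * ip r r
        ≤ (Λ - 2 * a) * ip r (K r) + a ^ 2 * ip r r := by nlinarith [h1]
      _ ≤ a ^ 2 * ip r r := by nlinarith [mul_nonpos_of_nonpos_of_nonneg hle h3]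
      _ ≤ max (a ^ 2) ((Λ - a) ^ 2) * ip r r := mul_le_mul_of_nonneg_right (le_max_left _ _) h4
  · calc ip (K r) (K r) - 2 * a * ip r (K r) + a ^ 2 * ip r r
        ≤ (Λ - 2 * a) * ip r (K r) + a ^ 2 * ip r r := by nlinarith [h1]
      _ ≤ (Λ - 2 * a) * (Λ * ip r r) + a ^ 2 * ip r r := by nlinarith [mul_le_mul_of_nonneg_left h2 hlt.le]
      _ = (Λ - a) ^ 2 * ip r r := by ring
      _ ≤ max (a ^ 2) ((Λ - a) ^ 2) * ip r r := mul_le_mul_of_nonneg_right (le_max_right _ _) h4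

/-- **What is free: variance ≤ Rayleigh value × spread.**  If `0 ≤ ip(y,Ky) ≤ Λ ip(y,y)` for ALL `y` (`Λ` = the top of the spectrum), then
`ip(Kx,Kx)ip(x,x) − ip(x,Kx)² ≤ ip(x,Kx)·(Λ ip(x,x) − ip(x,Kx))` (from `K² ≤ ΛK`). [cite: Kato1949, §1] -/
theorem variance_le_form_mul_spread (ip : D →ₗ[ℝ] D →ₗ[ℝ] ℝ) (hip : ∀ x y, ip x y = ip y x) (hip0 : ∀ y, 0 ≤ ip y y)
    (K : D →ₗ[ℝ] D) (hK : ∀ x y, ip (K x) y = ip x (K y)) (hpos : ∀ y, 0 ≤ ip y (K y)) {Λ : ℝ} (hΛ : 0 ≤ Λ)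
    (hdom : ∀ y, ip y (K y) ≤ Λ * ip y y) (x : D) :
    ip (K x) (K x) * ip x x - ip x (K x) ^ 2 ≤ ip x (K x) * (Λ * ip x x - ip x (K x)) := by
  have h1 := form_sq_le_dom ip hip hip0 K hK hpos (fun _ => True) (fun _ _ => trivial) hΛ (fun y _ => hdom y)
    (r := x) trivial
  nlinarith [h1, hip0 x]

end Abstract

end Summit.QuantumFields.YangMills.Theorems.FemtoTransferGap.LiftLeak

end
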